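import Summits.HodgeConjecture.HodgeConjecture.Theorems.Ring2AbelianAllAndreOddCellPencilKData
import HarnessLib

/-!
# Ring 2 · AbelianAll — ANDRÉ AXIS, PART U — U-h: (R3) ITSELF — THE ODD-DEGREE CROSS-SUM HALF INVERSE from (K) + (M′); `PencilKWeilData ⟹ B⋆(𝒳, η) ∀η` for every pencil of the pure-middle cell (Sketch §I)

HONEST FRAMING (page 1, verbatim): **research route, not a corollary; conditional on HC_CM plus one named minimal statement.** Cell line:
research route conditional on HC_CM; not a corollary; Q11.4-sentence-2 already refuted in dim ≥ 3. Nothing in this file proves a case of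
the Hodge conjecture or `B(X)` for a named `X`; `HC_CM`, `HC_AV` and the global nodes are ABSENT; every bracket / residual / crux below is a
HYPOTHESIS wherever used (`@[conjecture] def`), never asserted. Item `Theses.RankFourFaces.CMToAbelian` (stmt-16267) stays OPEN; N104 untouched.

PROVENANCE. Seat `pub-hodge-ring2-ab-andre-2`, gen 52 (PART U: the ODD CELL at relative dimension three on the André axis). The
mathematics of this part was PLANNED AND KERNEL-CHECKED AT MEMO LEVEL by the (lapsed) ideation seat vhodge-p6 (gens 0–6, 2026-08-25) in
`run/shared/lean/pub/vhodge/memos/ROUTE-P6-g4-Sketch.lean` (sha16 a5719f36; 2548 lines; farm rc 0, 0 sorries, 0 errors; re-checked by this seat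
2026-08-26T02:34Z, 60 s) on top of this seat's parts XXXV–T; it never entered the tree (the planner seat files nothing; director-hodge ruling
2026-08-25T21:26:55Z «(B) LAPSE with (A) banked»: landing the Sketch's statement vocabulary + kernel chain as Theorems files is cost item (A)(1)
of the banked ladder rung H1d′ «Lefschetz B for compact abelian-threefold pencils, odd cell»). This file is that landing for the sections named
in its title: declarations VERBATIM from the Sketch (namespace moved from `…VHodgeP6` to `…Ring2.AbelianAll.OddCell`, the memo-level `abbrev
FirstTarget` replaced by the constant `LefschetzBOddPencilsRelDimThree`, lint repairs, sections re-cut to the tree's 400-line files), credited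
decl by decl to the memo; the seat's own additions are marked «(ab-andre-2, gen 52)».

CONTENT (Sketch lines 2054–2250, 2260–2312): `map_tensorIso_map_whiskerRight_cross`; **`exists_halfInverse_of_kTop`** — under the `K`-action
charts (K) and the `K`-top statement (M′), at a member `t` with a surviving degree-3 class, the explicit cross sum
`W₀ = c₁·pr₁^*u₊ ∪ pr₂^*ι_t^*ū₊ + c₂·pr₁^*ū₊ ∪ pr₂^*ι_t^*u₊ ∈ H⁶(𝒳 × X_t)` IS a topological half inverse in degree `3` (isotropy by graded
commutativity, duality by part XLVIII's `exists_cupPairing_map_fiberι_ne_zero`, `ker ι_{t*} = R_t^⊥`, the action by `exists_crossFunctional`) with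
Weil-class restrictions on every twisted product member; `pencilWeilKDataAt₃_of_kTop`, `pencilWeilKDataAt₂_of_pencilKWeilData`,
**`lefschetzB_threefoldPencil_of_pencilKWeilData_of_verdier`** (THE CHAIN OF RECORD: `(K) + (M′) ⟹ B⋆(𝒳, η) ∀η` on the pure-middle cell, given
`ThetaGroupLaw[]`, Verdier, `SixfoldWeilHCFor d_K` and (N₂) at one member), `pencilWeilKData₃_of_pencilKWeilData`. EDGE LABELS: K / K[Verdier, SixfoldWeilHCFor].
-/

noncomputable section

namespace Summit.HodgeConjecture.HodgeConjecture.Ring2.AbelianAll.OddCell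

set_option linter.dupNamespace false

open CategoryTheory CategoryTheory.Limits AlgebraicGeometry MonoidalCategory CartesianMonoidalCategory
open Literature.AlgebraicGeometry Literature.AlgebraicGeometry.Motives
open Literature.AlgebraicGeometry.HodgeTheory
open Literature.AlgebraicTopology.SingularHomology
open Literature.AlgebraicGeometry.VanGeemen1994
open Literature.AlgebraicGeometry.Andre1996 (compactPencil_dim_eq_of_iso)
open Summit.HodgeConjecture.HodgeConjecture
open Summit.HodgeConjecture.HodgeConjecture.Theses
open Summit.HodgeConjecture.HodgeConjecture.Ring2.AbelianAll
open Summit.HodgeConjecture.HodgeConjecture.Theorems (deg_fiberGysin_aux exists_fibreClassInverse_deg_of_lefschetzBCompactPencils)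
open scoped MonObj

variable {𝒳 S : SchemeOver ℂ} {f : 𝒳 ⟶ S}

/-- DISPLAY-ONLY bracket, VERBATIM from ring 2 part XL-b (no `def`, not a node): every compact pencil of abelian varieties of
positive relative dimension carries `θ_N` (`N ≥ 2`) and an `S`-group law charted by `μ_A` at SOME member. PRINT-TRUE
(Mumford–Fogarty–Kirwan Thm. 6.14, Laurent–Schröer Prop. 4.3). -/
local notation3 (prettyPrint := false) "ThetaGroupLaw[]" =>
  ∀ ⦃k : ℕ⦄ ⦃𝒳 S : SchemeOver ℂ⦄ (f : 𝒳 ⟶ S), IsCompactAbelianPencil f (k + 1) →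
    ∃ (t : ComplexPoints S) (ν : 𝒳 ⟶ 𝒳) (hν : ν ≫ f = f) (N : ℕ) (mS : familyPullback f f ⟶ 𝒳), 2 ≤ N ∧
      (∀ s : ComplexPoints S, ∃ (νs : fiberOver f s ⟶ fiberOver f s) (A : AbelianVariety ℂ) (e : A.X ≅ fiberOver f s),
        νs ≫ fiberι f s = fiberι f s ≫ ν ∧ e.hom ≫ νs = (N • 𝟙 A).hom.hom.hom ≫ e.hom) ∧
      (familyPullback.isPullback f f).lift (familyPullback.fst f f ≫ ν) (familyPullback.snd f f ≫ ν)
          (familyPullback_pair_condition hν) ≫ mS = mS ≫ ν ∧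
      ∃ (νt : fiberOver f t ⟶ fiberOver f t) (A : AbelianVariety ℂ) (e : A.X ≅ fiberOver f t),
        νt ≫ fiberι f t = fiberι f t ≫ ν ∧ e.hom ≫ νt = (N • 𝟙 A).hom.hom.hom ≫ e.hom ∧
        (familyPullback.isPullback f f).lift (fst A.X A.X ≫ e.hom ≫ fiberι f t) (snd A.X A.X ≫ e.hom ≫ fiberι f t)
          (fibreChart_pair_condition t e) ≫ mS = μ[A.X] ≫ e.hom ≫ fiberι f t

/-- DISPLAY bracket: the TWISTED PRODUCT endomorphism `φ_s × (−φ_t)` of `A_s × A_t`. [cite: vanGeemen1994HodgeAV, 4.9] -/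
local notation3 (prettyPrint := false) "ΨK[" A ", " φ ", " s ", " t "]" =>
  AbelianVariety.prodLift (AbelianVariety.fst (A s) (A t) ≫ φ s) (AbelianVariety.snd (A s) (A t) ≫ (-(φ t)))

/-! ## §I  (R3) ITSELF FROM (K) + (M′) ON THE CELL — ring 2's cross-sum half inverse in ODD degree (g4)

PRINT = KERNEL HERE (no residual support lemma: (P0) below is PROVED). On the Weil cell, under the `K`-action charts (K) and the `K`-top
monodromy statement (M′): let `u₊` be §F4's `+`-part of a conjugation-fixed surviving class (§H3–§H4) and `u₋ := ū₊`; their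
restrictions `r± := ι_t^* u±` span `R_t := ι_t^* H³(𝒳; ℂ)` (each member line `⋀³V±(A_t)` IS a line, §G, and (M′) puts every
restriction in their sum); `r ∪ r = 0` in odd degree, so the invariant Poincaré pairing — non-degenerate on `R_t` by ring 2's
`exists_cupPairing_map_fiberι_ne_zero` (Deligne) — gives `⟨r₊ ∪ r₋, [X_t]⟩ ≠ 0`, and
  `W₀ := c₁ · pr₁^*u₊ ∪ pr₂^*r₋ + c₂ · pr₁^*u₋ ∪ pr₂^*r₊ ∈ H⁶(𝒳 × X_t)`, `c₁ = −1/τ(r₊ ∪ r₋)`, `c₂ = −1/τ(r₋ ∪ r₊)`,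
acts as the identity on `R_t` (`W₀_* r± = u±` EXACTLY) and kills `ker ι_{t*} = R_t^⊥` — ring 2's `exists_crossFunctional` and
`complexGysin_fiberι_eq_zero_iff`, used in ODD degree. Its member restrictions, through the charts `A_s × A_t ≅ X_s × X_t`, are
`c₁ · p₁^*(⋀³V₊(A_s)-class) ∪ p₂^*(e_t^* r₋) + c₂ · p₁^*(⋀³V₋(A_s)-class) ∪ p₂^*(e_t^* r₊)` — Weil classes of the twisted product
`(A_s × A_t, φ_s × (−φ_t))` AS SOON AS `e_t^* r₋ ∈ Eig_{χ₋}(φ_t) = ⋀³V₋(φ_t)` is known to lie in `Eig_{χ₊}(−φ_t) = ⋀³V₊(−φ_t)` (and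
`+ ↔ −`): in print the SAME line (`V₋(φ) = V₊(−φ)`); in the kernel two `pullbackEigenclasses` carriers (characters of `x𝟙 + yφ` vs
`x𝟙 + y(−φ)`), whose identification (P0) is member-level multilinear algebra — PROVED here (`kTopLinesNegSwap_of_pos`: §G's wedge-basis
calculus redone with the eigenbasis as a PARAMETER, `pullbackEigenclasses_pow_eq_span_wedge`, applied to `ψ` and `−ψ` with ONE basis, and
`(−ψ)^* = −ψ^*` on `H¹`, `complexBetti_map_neg_one`). Net: `PencilKWeilData` = (K) + (M′) is the g4 RESIDUAL OF RECORD.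
[cite: Andre1996Motifs, §5.2 (second proof)] [cite: VoisinHodgeII2003, proof of Thm. 10.17 (10.7)] [cite: DeligneHodgeII1971, Thm. 4.1.1]
[cite: vanGeemen1994HodgeAV, 4.8–4.9] [cite: Schoen1998HodgeWeilAddendum, §10 (proof, p. 333)] -/

/-- **Member restriction of a cross class through the charts**: `(e_s × e_t)^* (ι_s × X_t)^* (pr₁^* u ∪ pr₂^* y) =
p₁^*((e_s ≫ ι_s)^* u) ∪ p₂^*(e_t^* y)` on `A_s × A_t`. [cite: HatcherAT2002, §3.2 Prop. 3.10] -/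
theorem map_tensorIso_map_whiskerRight_cross (A : ComplexPoints S → AbelianVariety ℂ) (e : ∀ s, (A s).X ≅ fiberOver f s)
    (s t : ComplexPoints S) {i j k : ℕ} (h : i + j = k) (u : complexBetti 𝒳 i) (y : complexBetti (fiberOver f t) j) :
    complexBetti.map (tensorIso (e s) (e t)).hom k (complexBetti.map (fiberι f s ▷ fiberOver f t) k
      (cupProduct h (complexBetti.map (fst 𝒳 (fiberOver f t)) i u) (complexBetti.map (snd 𝒳 (fiberOver f t)) j y))) =
    cupProduct h (complexBetti.map (AbelianVariety.fst (A s) (A t)).hom.hom.hom i (complexBetti.map ((e s).hom ≫ fiberι f s) i u))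
      (complexBetti.map (AbelianVariety.snd (A s) (A t)).hom.hom.hom j (complexBetti.map (e t).hom j y)) := by
  have h1 : complexBetti.map (tensorIso (e s) (e t)).hom i (complexBetti.map (fiberι f s ▷ fiberOver f t) i
      (complexBetti.map (fst 𝒳 (fiberOver f t)) i u)) =
      complexBetti.map (AbelianVariety.fst (A s) (A t)).hom.hom.hom i (complexBetti.map ((e s).hom ≫ fiberι f s) i u) := by
    rw [← complexBetti.map_comp_apply', ← complexBetti.map_comp_apply', Category.assoc, whiskerRight_fst, tensorIso_hom,
      tensorHom_fst_assoc, complexBetti.map_comp_apply' (fst (A s).X (A t).X) ((e s).hom ≫ fiberι f s)]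
    rfl
  have h2 : complexBetti.map (tensorIso (e s) (e t)).hom j (complexBetti.map (fiberι f s ▷ fiberOver f t) j
      (complexBetti.map (snd 𝒳 (fiberOver f t)) j y)) =
      complexBetti.map (AbelianVariety.snd (A s) (A t)).hom.hom.hom j (complexBetti.map (e t).hom j y) := by
    rw [← complexBetti.map_comp_apply', ← complexBetti.map_comp_apply', Category.assoc, whiskerRight_snd, tensorIso_hom,
      tensorHom_snd, complexBetti.map_comp_apply' (snd (A s).X (A t).X) (e t).hom]
    rfl
  rw [complexBetti.map_cupProduct, complexBetti.map_cupProduct, h1, h2]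
  rfl

/-- **§I. (R3) FROM (K) + (M′) ON THE CELL — the half inverse EXISTS.** For a threefold pencil with `K`-action charts
`(Φ; A_s, e_s, φ_s)`, the `K`-top monodromy statement (M′) (and the theorem (P0) in degree `3`), and a surviving degree-3 class at
`t`, the explicit cross-sum `W₀ = c₁ · pr₁^*u₊ ∪ pr₂^*r₋ + c₂ · pr₁^*u₋ ∪ pr₂^*r₊` is a topological half inverse at `t` with Weil-class
member restrictions on every twisted product `(A_s × A_t, φ_s × (−φ_t))`. Fact-free given the inputs (ring-2 kernel: Lieberman–Fourier
functional, `ker ι_{t*} = R_t^⊥`, invariant pairing; §F4, §G, §H). [cite: Andre1996Motifs, §5.2] [cite: VoisinHodgeII2003, proof of Thm. 10.17]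
[cite: DeligneHodgeII1971, Thm. 4.1.1] [cite: vanGeemen1994HodgeAV, 4.8–4.9 and 6.12] [cite: Schoen1998HodgeWeilAddendum, §10 (proof, p. 333)] -/
theorem exists_halfInverse_of_kTop {dK : ℕ} (hf : IsCompactAbelianPencil f (2 + 1)) (t : ComplexPoints S) (hdK : 0 < dK)
    (Φ : 𝒳 ⟶ 𝒳) (A : ComplexPoints S → AbelianVariety ℂ) (e : ∀ s, (A s).X ≅ fiberOver f s) (φ : ∀ s, A s ⟶ A s)
    (_hΦ : Φ ≫ f = f) (hφ : ∀ s, φ s ≫ φ s = -(dK • 𝟙 (A s)))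
    (hK : ∀ s, ∃ Φs : fiberOver f s ⟶ fiberOver f s, Φs ≫ fiberι f s = fiberι f s ≫ Φ ∧ (e s).hom ≫ Φs = (φ s).hom.hom.hom ≫ (e s).hom)
    (hM : ∀ (s) (W : complexBetti 𝒳 (2 + 1)), complexBetti.map ((e s).hom ≫ fiberι f s) (2 + 1) W ∈
      pullbackEigenclasses (A s) (φ s) (2 + 1) (chiPlus dK (2 + 1)) ⊔ pullbackEigenclasses (A s) (φ s) (2 + 1) (chiMinus dK (2 + 1)))
    (hcell : ∃ W : complexBetti 𝒳 (2 + 1), complexBetti.map (fiberι f t) (2 + 1) W ≠ 0) :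
    ∃ W₀ : complexBetti (𝒳 ⊗ fiberOver f t) (2 * (2 + 1)),
      (∀ W, complexBetti.map (fiberι f t) 3 (corrAction complexOrientationFamily (IsCompactAbelianPencil.isSmoothProjective_total hf)
          (IsCompactAbelianPencil.isSmoothProjective_fiberOver hf t) (rfl : 3 + 2 * (2 + 1) = 3 + 2 * (2 + 1)) W₀
          (complexBetti.map (fiberι f t) 3 W)) = complexBetti.map (fiberι f t) 3 W) ∧
      (∀ x, complexGysin complexOrientationFamily (IsCompactAbelianPencil.isSmoothProjective_fiberOver hf t)
          (IsCompactAbelianPencil.isSmoothProjective_total hf) (fiberι f t) (deg_fiberGysin_aux 3 (2 + 1)) x = 0 →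
        complexBetti.map (fiberι f t) 3 (corrAction complexOrientationFamily (IsCompactAbelianPencil.isSmoothProjective_total hf)
          (IsCompactAbelianPencil.isSmoothProjective_fiberOver hf t) (rfl : 3 + 2 * (2 + 1) = 3 + 2 * (2 + 1)) W₀ x) = 0) ∧
      (∀ s, complexBetti.map (tensorIso (e s) (e t)).hom (2 * (2 + 1)) (complexBetti.map (fiberι f s ▷ fiberOver f t) (2 * (2 + 1)) W₀) ∈
        weilClassesOf ((A s).prod (A t)) ΨK[A, φ, s, t] (2 + 1) dK) := by
  classical
  have h33 : 3 + 3 = 2 * (2 + 1) := rfl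
  have hdim : (A t).dim = 2 + 1 := compactPencil_dim_eq_of_iso hf (e t)
  -- the chart at `t` is an isomorphism on cohomology
  have hiso : ∀ x : complexBetti 𝒳 3, complexBetti.map (fiberι f t) 3 x =
      complexBetti.map (e t).inv 3 (complexBetti.map ((e t).hom ≫ fiberι f t) 3 x) := fun x ↦ by
    rw [← complexBetti.map_comp_apply', Iso.inv_hom_id_assoc]
  -- §I-1  the global classes `u₊` (§H3–§H4, §F4) and `u₋ := ū₊`
  obtain ⟨W₁, hW₁⟩ := hcell
  obtain ⟨W, hWfix, hWt⟩ := exists_conjFixed_map_fiberι_ne_zero t hW₁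
  obtain ⟨hup', hupt'⟩ := kPlusPart_upData hdK ⟨1, rfl⟩ Φ A e φ hK t W (fun s ↦ hM s W)
    (map_not_mem_pullbackEigenclasses_chiMinus_of_conjFixed hdK ⟨1, rfl⟩ A e φ t hWfix hWt)
  obtain ⟨up, hup, hupt⟩ : ∃ u : complexBetti 𝒳 3,
      (∀ s, complexBetti.map ((e s).hom ≫ fiberι f s) 3 u ∈ pullbackEigenclasses (A s) (φ s) (2 + 1) (chiPlus dK (2 + 1))) ∧
        complexBetti.map (fiberι f t) 3 u ≠ 0 := ⟨_, hup', hupt'⟩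
  obtain ⟨um, hum_def⟩ : ∃ u : complexBetti 𝒳 3, u = conjClass (Motives.ComplexPoints 𝒳) 3 up := ⟨_, rfl⟩
  have hum : ∀ s, complexBetti.map ((e s).hom ≫ fiberι f s) 3 um ∈ pullbackEigenclasses (A s) (φ s) (2 + 1) (chiMinus dK (2 + 1)) := by
    intro s
    rw [hum_def, ← conjClass_map (Motives.AlgPoints.mapContinuous (L := ℂ) ((e s).hom ≫ fiberι f s)) up]
    exact conjClass_mem_pullbackEigenclasses_chiMinus_of_chiPlus (hup s)
  have humt : complexBetti.map (fiberι f t) 3 um ≠ 0 := by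
    rw [hum_def, ← conjClass_map (Motives.AlgPoints.mapContinuous (L := ℂ) (fiberι f t)) up]
    exact conjClass_ne_zero hupt
  have hRp0 : complexBetti.map ((e t).hom ≫ fiberι f t) 3 up ≠ 0 := fun h ↦ hupt (by rw [hiso, h, map_zero])
  have hRm0 : complexBetti.map ((e t).hom ≫ fiberι f t) 3 um ≠ 0 := fun h ↦ humt (by rw [hiso, h, map_zero])
  -- §I-2  `R_t = ℂ r₊ ⊕ ℂ r₋`: the member lines are lines (§G) and (M′)
  have hLp : Module.finrank ℂ (pullbackEigenclasses (A t) (φ t) (2 + 1) (chiPlus dK (2 + 1))) = 1 :=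
    finrank_pullbackEigenclasses_chiPlus_eq_one hdim hdK (hφ t)
  have hLm : Module.finrank ℂ (pullbackEigenclasses (A t) (φ t) (2 + 1) (chiMinus dK (2 + 1))) = 1 :=
    finrank_pullbackEigenclasses_chiMinus_eq_one hdim hdK (hφ t)
  have hspan : ∀ V : complexBetti 𝒳 3, ∃ a b : ℂ, complexBetti.map (fiberι f t) 3 V =
      a • complexBetti.map (fiberι f t) 3 up + b • complexBetti.map (fiberι f t) 3 um := by
    intro V
    obtain ⟨cp, hcp, cm, hcm, hsum⟩ := Submodule.mem_sup.1 (hM t V)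
    obtain ⟨a, ha⟩ := exists_smul_eq_of_finrank_eq_one' hLp (hup t) hRp0 hcp
    obtain ⟨b, hb⟩ := exists_smul_eq_of_finrank_eq_one' hLm (hum t) hRm0 hcm
    refine ⟨a, b, ?_⟩
    have hV : complexBetti.map ((e t).hom ≫ fiberι f t) 3 V = cp + cm := hsum.symm
    have h1 : complexBetti.map ((e t).hom ≫ fiberι f t) 3 V = complexBetti.map ((e t).hom ≫ fiberι f t) 3 (a • up + b • um) := by
      rw [hV, map_add, map_smul, map_smul, ha, hb]
    rw [hiso V, h1, ← hiso, map_add, map_smul, map_smul]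
  -- §I-3  odd degree: `r ∪ r = 0`; pairings; `⟨r₊ ∪ r₋, [X_t]⟩ ≠ 0`
  have hself : ∀ r : complexBetti (fiberOver f t) 3, cupProduct h33 r r = 0 := by
    intro r
    have h := cupProduct_gradedComm_holds ℂ (Motives.ComplexPoints (fiberOver f t)) h33 h33 r r
    rw [show ((-1 : ℂ) ^ (3 * 3)) = -1 by norm_num, neg_one_smul] at h
    have h2 : (2 : ℂ) • cupProduct h33 r r = 0 := by
      rw [two_smul]
      nth_rewrite 2 [h]
      exact add_neg_cancel _
    exact (smul_eq_zero.1 h2).resolve_left two_ne_zero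
  have hpair0 : ∀ x y : complexBetti (fiberOver f t) 3,
      cupPairing (complexOrientationFamily (hf.isSmoothProjectiveFamily.isSmoothProjective t)) h33 x y = 0 → cupProduct h33 x y = 0 := by
    intro x y h
    rw [cupPairing_apply] at h
    refine eq_zero_of_traceC_eq_zero (IsCompactAbelianPencil.isSmoothProjective_fiberOver hf t) ?_
    rw [traceC_apply, mul_eq_zero]
    exact Or.inr h
  have hpm : cupProduct h33 (complexBetti.map (fiberι f t) 3 up) (complexBetti.map (fiberι f t) 3 um) ≠ 0 := by
    obtain ⟨z, hz⟩ := exists_cupPairing_map_fiberι_ne_zero hf.isSmoothProjective_base hf.isSmoothProjectiveFamily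
      hf.isSmoothProjective_total h33 t up hupt
    obtain ⟨a, b, hab⟩ := hspan z
    intro h0
    apply hz
    rw [hab, map_add, map_smul, map_smul, cupPairing_apply, cupPairing_apply, hself, h0, map_zero, LinearMap.zero_apply,
      smul_zero, smul_zero, add_zero]
  -- the Lieberman–Fourier functional and the two normalising constants
  obtain ⟨τ, hτ0, hτ⟩ := exists_crossFunctional (IsCompactAbelianPencil.isSmoothProjective_total hf)
    (IsCompactAbelianPencil.isSmoothProjective_fiberOver hf t)
  have hT₁ : τ (cupProduct h33 (complexBetti.map (fiberι f t) 3 up) (complexBetti.map (fiberι f t) 3 um)) ≠ 0 :=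
    fun h ↦ hpm (hτ0 _ h)
  have hT₂ : τ (cupProduct h33 (complexBetti.map (fiberι f t) 3 um) (complexBetti.map (fiberι f t) 3 up)) ≠ 0 := by
    intro h
    apply hpm
    have hc := cupProduct_gradedComm_holds ℂ (Motives.ComplexPoints (fiberOver f t)) h33 h33
      (complexBetti.map (fiberι f t) 3 up) (complexBetti.map (fiberι f t) 3 um)
    rw [hτ0 _ h, smul_zero] at hc
    exact hc
  obtain ⟨c₁, hc₁⟩ : ∃ c : ℂ, c = -(τ (cupProduct h33 (complexBetti.map (fiberι f t) 3 up) (complexBetti.map (fiberι f t) 3 um)))⁻¹ :=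
    ⟨_, rfl⟩
  obtain ⟨c₂, hc₂⟩ : ∃ c : ℂ, c = -(τ (cupProduct h33 (complexBetti.map (fiberι f t) 3 um) (complexBetti.map (fiberι f t) 3 up)))⁻¹ :=
    ⟨_, rfl⟩
  -- §I-4  the half inverse
  obtain ⟨W₀, hW₀⟩ : ∃ W₀ : complexBetti (𝒳 ⊗ fiberOver f t) (2 * (2 + 1)), W₀ =
      c₁ • cupProduct h33 (complexBetti.map (fst 𝒳 (fiberOver f t)) 3 up)
          (complexBetti.map (snd 𝒳 (fiberOver f t)) 3 (complexBetti.map (fiberι f t) 3 um)) +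
        c₂ • cupProduct h33 (complexBetti.map (fst 𝒳 (fiberOver f t)) 3 um)
          (complexBetti.map (snd 𝒳 (fiberOver f t)) 3 (complexBetti.map (fiberι f t) 3 up)) := ⟨_, rfl⟩
  have hact : ∀ c : complexBetti (fiberOver f t) 3,
      corrAction complexOrientationFamily (IsCompactAbelianPencil.isSmoothProjective_total hf)
        (IsCompactAbelianPencil.isSmoothProjective_fiberOver hf t) (rfl : 3 + 2 * (2 + 1) = 3 + 2 * (2 + 1)) W₀ c =
      (c₁ * -τ (cupProduct h33 c (complexBetti.map (fiberι f t) 3 um))) • up +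
        (c₂ * -τ (cupProduct h33 c (complexBetti.map (fiberι f t) 3 up))) • um := by
    intro c
    rw [hW₀, map_add, LinearMap.add_apply, map_smul, map_smul, LinearMap.smul_apply, LinearMap.smul_apply,
      hτ h33 (rfl : 3 + 2 * (2 + 1) = 3 + 2 * (2 + 1)) h33, hτ h33 (rfl : 3 + 2 * (2 + 1) = 3 + 2 * (2 + 1)) h33,
      smul_smul, smul_smul, show ((-1 : ℂ) ^ (3 * 3)) = -1 by norm_num, neg_one_mul, neg_one_mul]
  refine ⟨W₀, fun V ↦ ?_, fun x hx ↦ ?_, fun s ↦ ?_⟩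
  · -- (a) identity on `R_t`
    obtain ⟨a, b, hab⟩ := hspan V
    rw [hab, map_add, map_smul, map_smul, hact, hact]
    simp only [hself, map_zero, neg_zero, mul_zero, zero_smul, add_zero, zero_add]
    rw [hc₁, hc₂, neg_mul_neg, neg_mul_neg, inv_mul_cancel₀ hT₁, inv_mul_cancel₀ hT₂, one_smul, one_smul, map_add, map_smul,
      map_smul]
  · -- (b) kills `ker ι_{t*} = R_t^⊥`
    have hx' := (complexGysin_fiberι_eq_zero_iff hf.isSmoothProjective_base hf.isSmoothProjectiveFamily hf.isSmoothProjective_total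
      (deg_fiberGysin_aux 3 (2 + 1)) h33 t x).1 hx
    rw [hact, hpair0 _ _ (hx' um), hpair0 _ _ (hx' up), map_zero, neg_zero, mul_zero, mul_zero, zero_smul, zero_smul, add_zero,
      map_zero]
  · -- (c) member restrictions are Weil classes of the twisted product
    have hp₁ : AbelianVariety.fst (A s) (A t) ≫ φ s = ΨK[A, φ, s, t] ≫ AbelianVariety.fst (A s) (A t) :=
      (AbelianVariety.prodLift_fst _ _).symm
    have hp₂ : AbelianVariety.snd (A s) (A t) ≫ (-(φ t)) = ΨK[A, φ, s, t] ≫ AbelianVariety.snd (A s) (A t) :=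
      (AbelianVariety.prodLift_snd _ _).symm
    have hbm : complexBetti.map (e t).hom 3 (complexBetti.map (fiberι f t) 3 um) ∈
        pullbackEigenclasses (A t) (-(φ t)) (2 + 1) (chiPlus dK (2 + 1)) := by
      rw [← complexBetti.map_comp_apply']
      exact (kTopLinesNegSwap_of_pos hdK (A t) (φ t) hdim (hφ t)).1 (hum t)
    have hbp : complexBetti.map (e t).hom 3 (complexBetti.map (fiberι f t) 3 up) ∈
        pullbackEigenclasses (A t) (-(φ t)) (2 + 1) (chiMinus dK (2 + 1)) := by
      rw [← complexBetti.map_comp_apply']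
      exact (kTopLinesNegSwap_of_pos hdK (A t) (φ t) hdim (hφ t)).2 (hup t)
    have hm₁ := cupProduct_map_map_mem_pullbackEigenclasses hp₁ hp₂ h33 (hup s) hbm
    have hm₂ := cupProduct_map_map_mem_pullbackEigenclasses hp₁ hp₂ h33 (hum s) hbp
    rw [chiPlus_mul_chiPlus] at hm₁
    rw [chiMinus_mul_chiMinus] at hm₂
    simp only [hW₀, map_add, map_smul]
    rw [map_tensorIso_map_whiskerRight_cross A e s t h33, map_tensorIso_map_whiskerRight_cross A e s t h33]
    show _ ∈ weilClassesPlus ((A s).prod (A t)) ΨK[A, φ, s, t] (2 + 1) dK ⊔ weilClassesMinus ((A s).prod (A t)) ΨK[A, φ, s, t] (2 + 1) dK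
    exact Submodule.add_mem _ (Submodule.smul_mem _ _ (Submodule.mem_sup_left hm₁))
      (Submodule.smul_mem _ _ (Submodule.mem_sup_right hm₂))

/-- **`PencilWeilKDataAt₃` INHABITED from (K) + (M′) + a surviving class** (the charts of the conclusion ARE the given ones).
[cite: Andre1996Motifs, §5.2] [cite: vanGeemen1994HodgeAV, 4.8–4.9] -/
theorem pencilWeilKDataAt₃_of_kTop {dK : ℕ} (hf : IsCompactAbelianPencil f (2 + 1)) (t : ComplexPoints S) (hdK : 0 < dK)
    (Φ : 𝒳 ⟶ 𝒳) (A : ComplexPoints S → AbelianVariety ℂ) (e : ∀ s, (A s).X ≅ fiberOver f s) (φ : ∀ s, A s ⟶ A s)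
    (hΦ : Φ ≫ f = f) (hφ : ∀ s, φ s ≫ φ s = -(dK • 𝟙 (A s)))
    (hK : ∀ s, ∃ Φs : fiberOver f s ⟶ fiberOver f s, Φs ≫ fiberι f s = fiberι f s ≫ Φ ∧ (e s).hom ≫ Φs = (φ s).hom.hom.hom ≫ (e s).hom)
    (hM : ∀ (s) (W : complexBetti 𝒳 (2 + 1)), complexBetti.map ((e s).hom ≫ fiberι f s) (2 + 1) W ∈
      pullbackEigenclasses (A s) (φ s) (2 + 1) (chiPlus dK (2 + 1)) ⊔ pullbackEigenclasses (A s) (φ s) (2 + 1) (chiMinus dK (2 + 1)))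
    (hcell : ∃ W : complexBetti 𝒳 (2 + 1), complexBetti.map (fiberι f t) (2 + 1) W ≠ 0) :
    PencilWeilKDataAt₃ hf t dK := by
  obtain ⟨W₀, ha, hb, hW⟩ := exists_halfInverse_of_kTop hf t hdK Φ A e φ hΦ hφ hK hM hcell
  exact ⟨Φ, A, e, φ, W₀, hdK, hΦ, hφ, hK, hM, ha, hb, hW⟩

/-- **`PencilKWeilData` + a surviving class at `t` ⟹ `PencilWeilKDataAt₂` at `t`** ((R1′), (R2), (R3), (P0) all discharged).
[cite: Andre1996Motifs, §5.2] [cite: vanGeemen1994HodgeAV, 4.8–4.9 and 6.12] [cite: DeligneHodgeII1971, Thm. 4.1.1] -/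
theorem pencilWeilKDataAt₂_of_pencilKWeilData (hf : IsCompactAbelianPencil f (2 + 1)) {dK : ℕ} (hdK : 0 < dK)
    (h : PencilKWeilData hf dK) (t : ComplexPoints S)
    (hcell : ∃ W : complexBetti 𝒳 (2 + 1), complexBetti.map (fiberι f t) (2 + 1) W ≠ 0) :
    PencilWeilKDataAt₂ hf t dK := by
  obtain ⟨Φ, A, e, φ, hΦ, hφ, hK, hM⟩ := h
  exact pencilWeilKDataAt₂_of_pencilWeilKDataAt₃ hf t
    (pencilWeilKDataAt₃_of_kTop hf t hdK Φ A e φ hΦ hφ hK hM hcell) hcell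

/-- **THE g4 CHAIN OF RECORD (pencil of the pure-middle cell): `(K) + (M′)` ⟹ `B⋆(𝒳, η) ∀ η`**, given the nodes / Verdier / Weil-sixfold
brackets and (N₂) at one member: every member carries a surviving degree-3 class (cell + André flatness), so
§I inhabits `PencilWeilKDataAt₃` at every member and §H5's assembly applies. [cite: Andre1996Motifs, Lemme 5.1, §5.2–5.3]
[cite: Verdier1976, Cor. 5.1] [cite: Andre1992, Thm. 1] [cite: vanGeemen1994HodgeAV, 6.12] [cite: DeligneHodgeII1971, Thm. 4.1.1] -/
theorem lefschetzB_threefoldPencil_of_pencilKWeilData_of_verdier (hΘ : ThetaGroupLaw[]) (hGT : Verdier1976_genericLocalTriviality)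
    {dK : ℕ} (hHC : SixfoldWeilHCFor dK) ⦃𝒳 S : SchemeOver ℂ⦄ ⦃f : 𝒳 ⟶ S⦄
    (hf : IsCompactAbelianPencil f (2 + 1)) (hdK : 0 < dK)
    (hodd : ∀ t : ComplexPoints S, ¬ OddRestrictionsVanishAt f (2 + 1) t) (hout : ∃ t : ComplexPoints S, OddOuterRestrictionsVanishAt f (2 + 1) t)
    {t₀ : ComplexPoints S} (hN2 : DivisorSpannedInvariantHTwoAt hf t₀) (hdata : PencilKWeilData hf dK) :
    ∀ ηX : complexBetti 𝒳 2, StandardConjectureBStar (2 + 1 + 1) 𝒳 ηX := by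
  obtain ⟨Φ, A, e, φ, hΦ, hφ, hK, hM⟩ := hdata
  obtain ⟨t₁, ht₁⟩ := hout
  exact lefschetzB_threefoldPencil_of_pencilWeilKData₃_of_verdier hΘ hGT hHC hf hodd ⟨t₁, ht₁⟩ hN2 fun t ↦
    pencilWeilKDataAt₃_of_kTop hf t hdK Φ A e φ hΦ hφ hK hM
      (odd_and_exists_map_fiberι_ne_zero_of_not_oddRestrictionsVanishAt (hodd t) (oddOuterRestrictionsVanishAt_of_at hf ht₁ t)).2

/-- `PencilKWeilData` ⟹ `PencilWeilKData₃` on the pure-middle cell (the SAME charts at every member — this is why §I is stated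
over given charts). [cite: Andre1996Motifs, §5.2] [cite: Andre1992, Thm. 1] -/
theorem pencilWeilKData₃_of_pencilKWeilData ⦃𝒳 S : SchemeOver ℂ⦄ ⦃f : 𝒳 ⟶ S⦄ (hf : IsCompactAbelianPencil f (2 + 1)) {dK : ℕ}
    (hdK : 0 < dK)
    (hodd : ∀ t : ComplexPoints S, ¬ OddRestrictionsVanishAt f (2 + 1) t) (hout : ∃ t : ComplexPoints S, OddOuterRestrictionsVanishAt f (2 + 1) t)
    (hdata : PencilKWeilData hf dK) : PencilWeilKData₃ hf dK := by
  obtain ⟨Φ, A, e, φ, hΦ, hφ, hK, hM⟩ := hdata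
  obtain ⟨t₁, ht₁⟩ := hout
  refine ⟨Φ, A, e, φ, hdK, hΦ, hφ, hK, hM, fun t ↦ ?_⟩
  exact exists_halfInverse_of_kTop hf t hdK Φ A e φ hΦ hφ hK hM
    (odd_and_exists_map_fiberι_ne_zero_of_not_oddRestrictionsVanishAt (hodd t) (oddOuterRestrictionsVanishAt_of_at hf ht₁ t)).2

end Summit.HodgeConjecture.HodgeConjecture.Ring2.AbelianAll.OddCell

end
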